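import Mathlib.Analysis.InnerProductSpace.Positive
import Mathlib.Analysis.InnerProductSpace.Adjoint
import Mathlib.Analysis.InnerProductSpace.StarOrder
import HarnessLib

/-!
# Barrier: the «positive-operator cutoff» route to semi-local Weil positivity needs the ratio of local factors to be INNER — and it is not (Connes–Consani 2019/2021, «The scaling Hamiltonian», §3)

Barrier catalogue `Literature/Barriers/RiemannHypothesis/` (D-0021), entry `SemilocalCutoffInnerCriterion`
(namespace `Literature.Barriers.RiemannHypothesis`; the catalogued declaration is `SemilocalCutoffInnerCriterion`,
PROVED outright as `SemilocalCutoffInnerCriterion_holds` from `innerCriterion_tfae`). Everything in this file is a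
THEOREM (pure operator theory on a complex Hilbert space); the one `def … : Prop` is discharged in the file, so there
is no named fact, and nothing here bears on the truth of RH.

## The technique (X.-J. Li's 2019 attempt, as analysed by Connes–Consani)

Connes–Consani, §3 (arXiv pp. 14–15): in the semi-local trace formula the sum of the local Weil terms
`Σ_{v ∈ S} ∫'_{ℚ_v^*} |w|^{1/2} |1-w|⁻¹ h(w) d*w` is a trace `Tr(ĥ₁ (½ u⁻¹ đu) ĥ₂)`, where `u = ∏_{v∈S} u_v`
is the unitary «ratio of local factors on the critical line», `F = 2P - 1` for the cutoff projection `P`,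
and `đu := [F, u]` is the quantized differential (Def. 2.1, p. 10). «The idea of X.-J. Li is to replace
the operator `R_Λ = P̂_Λ P_Λ` by the positive operator `T = P 𝒫̂ P` … One gets … `T = P u* (1 - P) u P`.
One sees that Fact 3.1 [`Tr(AB) ≥ 0` for positive `A`, `B` with `AB` trace class] would imply [the Weil
inequality (3.1)] provided one could prove that `P u* (1-P) u P = -½ u⁻¹ đu`.» (p. 15)

## The obstruction (what this file vendors, AS PRINTED, and proves)

«LEMMA 3.4. Let `ℋ` be a Hilbert space, `u` a unitary operator and `F = 2P - 1`, where `P` is an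
orthogonal projection. Then, with `đu := [F, u]`, the following three conditions are equivalent:
(i) `P u* (1 - P) u P = -½ u⁻¹ đu`; (ii) `u⁻¹ đu ≤ 0`; (iii) `P u = P u P`.» (p. 15) — PROVED below as
`innerCriterion_tfae` (with the three implications as separate theorems). «COROLLARY 3.5. … the
equivalent conditions of Lemma 3.4 hold if and only if `u*` is an inner function in the sense of
Beurling» (p. 15; the Hardy-space dictionary for `P` = the Hardy projection — not formalised here).
The arithmetic verdict (pp. 16–17): `u_p(z) = (1 - p^{-(1-z)})/(1 - p^{-z})` is holomorphic but
UNBOUNDED in `Re z > ½` («`∼ -p^{z-1}`, `z → ∞`») and the archimedean ratio `φ(z)` is unbounded there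
(«`φ(20) ≈ 26.4562`»), so «none of the functions `u_v(s)*` fulfills the requirement of Corollary 3.5»;
and «FACT 3.6. The inequality (3.1) does not hold in general» (for `S = {∞}` it would force the
Riemann–Siegel angular function `θ` to be monotonic, «by looking at its graph … it is not the case»).

technique_class: semilocal-trace-formula positive-operator cutoff — prove Weil's inequality for the
  places `S` by writing `Σ_{v∈S} W_v(h₁ * h₁*)` as minus the trace of the manifestly positive operator
  `P u*(1-P) u P · ĥ₁ ĥ₁*` (Li 2019, unpublished; described in [ConnesConsani2021ScalingHamiltonian, §3]).
blocks: the identity `P u*(1-P) u P = -½ u⁻¹[F,u]` that the route needs — by `innerCriterion_tfae` it holds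
  iff `P u = P u P` (the range of `P` is `u`-invariant), i.e. iff `u*` is inner
  [cite: ConnesConsani2021ScalingHamiltonian, Lemma 3.4 and Cor. 3.5 (arXiv:1910.14368 p. 15)].
because: for the ratios of local factors `u_p`, `u_∞` this invariance fails — they are not bounded in the
  half-plane `Re z > ½` [cite: ConnesConsani2021ScalingHamiltonian, §3 pp. 16–17 («none of the functions
  u_v(s)* fulfills the requirement of Corollary 3.5»)]; and the unconstrained inequality (3.1) is false
  already for `S = {∞}` [cite: ConnesConsani2021ScalingHamiltonian, Fact 3.6 (p. 17)].
evasions_known: impose the SUPPORT condition `supp g ⊂ (q^{-1/2}, q^{1/2})` and the two vanishing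
  conditions `∫ h₁ x^{±1/2} d*x = 0` — the authors' own Conjecture 4.1 (p. 18) and programme («find a way
  to make use of the support condition», p. 21), carried out for `S = {∞}` in Connes–Consani, Selecta
  Math. 27 (2021) Thm 1 [cite: ConnesConsani2021, Thm. 1]; computer-assisted finite-section certificates
  (Yoshida 1992 Thm 1; the tree's `weilPositivityOn_log5half`) do not use the operator `T` at all.
scope_caveats: the printed no-go refutes ONE mechanism (the positive-operator identity) and the
  UNCONSTRAINED inequality (3.1); it says nothing against positivity statements that use the support
  and vanishing conditions (the authors: «a priori, the inequality (3.1) could still hold …», p. 17).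
  Only Lemma 3.4 is formalised here; Cor. 3.5 (Beurling inner functions), the unboundedness of `u_p`,
  `φ` and Fact 3.6 (Riemann–Siegel `θ`) are cited, not proved. The 2019 manuscript of Li is not public;
  Li's arXiv:0807.0090 (2008; withdrawn v4; v5–v10 2024–2025) is a different, unrefereed text that
  print does not connect to this analysis.
status: established (J. Operator Theory 85 (2021) 259–278, refereed; Lemma 3.4 kernel-checked here).

## References

* [ConnesConsani2021ScalingHamiltonian] A. Connes, C. Consani, *The scaling Hamiltonian*,
  J. Operator Theory 85 (2021), no. 1, 259–278; doi:10.7900/jot.2019oct30.2265; arXiv:1910.14368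
  (read: arXiv v1 pp. 2, 10, 13–18, 20–21; Def. 2.1, Lemma 2.4, Thm 2.5, Facts 3.1–3.3, Lemma 3.4,
  Cor. 3.5, Fact 3.6, Conj. 4.1).
* [ConnesConsani2021] A. Connes, C. Consani, *Weil positivity and trace formula, the archimedean
  place*, Selecta Math. (N.S.) 27 (2021) 77 (the `S = {∞}` evasion; cited only).
-/

noncomputable section

open ContinuousLinearMap
open scoped InnerProductSpace ComplexOrder

namespace Literature.Barriers.RiemannHypothesis

variable {H : Type*} [NormedAddCommGroup H] [InnerProductSpace ℂ H] [CompleteSpace H]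

/-- The sign operator `F = 2P − 1` of a projection `P` (Connes–Consani Def. 2.1 uses `F = 2P_+ − 1`;
Lemma 3.4 takes any orthogonal projection). [cite: ConnesConsani2021ScalingHamiltonian, Def. 2.1 (arXiv p. 10), Lemma 3.4 (p. 15)] -/
def cutoffSign (P : H →L[ℂ] H) : H →L[ℂ] H := (2 : ℂ) • P - 1

/-- The quantized differential `đu := [F, u] = F u − u F` with `F = 2P − 1`.
[cite: ConnesConsani2021ScalingHamiltonian, Def. 2.1 (arXiv p. 10)] -/
def quantizedDiff (P u : H →L[ℂ] H) : H →L[ℂ] H := cutoffSign P * u - u * cutoffSign P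

omit [CompleteSpace H] in
/-- Unfolding lemma for `cutoffSign` (private plumbing). [folklore] -/
private theorem cutoffSign_def (P : H →L[ℂ] H) : cutoffSign P = (2 : ℂ) • P - 1 := rfl

omit [CompleteSpace H] in
/-- Unfolding lemma for `quantizedDiff` (private plumbing). [folklore] -/
private theorem quantizedDiff_def (P u : H →L[ℂ] H) :
    quantizedDiff P u = cutoffSign P * u - u * cutoffSign P := rfl

/-- `u* đu = 2 (u* P u − P)` for `u* u = 1`: the «logarithmic derivative» of a unitary against the cutoff.
[cite: ConnesConsani2021ScalingHamiltonian, §3 p. 15 (the identity behind (i) ⟺ (ii))] -/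
theorem star_mul_quantizedDiff {P u : H →L[ℂ] H} (hu : star u * u = 1) :
    star u * quantizedDiff P u = (2 : ℂ) • (star u * P * u - P) := by
  simp only [quantizedDiff_def, cutoffSign_def, mul_sub, sub_mul, mul_one, smul_mul_assoc, mul_smul_comm,
    smul_sub, ← mul_assoc, hu, one_mul]
  abel

/-- `P u* (1 − P) u P = P − P (u* P u) P` for `u* u = 1` and `P² = P` — the first line of the printed proof of (iii) ⟹ (i)
(«the projection `Q = u* P u` … `P u*(1−P) u P = P(1 − Q)P = P − Q`»). [cite: ConnesConsani2021ScalingHamiltonian, Lemma 3.4, proof of (iii)⟹(i) (arXiv pp. 15–16)] -/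
theorem conj_compl_eq {P u : H →L[ℂ] H} (hu : star u * u = 1) (hP : IsIdempotentElem P) :
    P * star u * (1 - P) * u * P = P - P * (star u * P * u) * P := by
  have hPP : P * P = P := hP.eq
  simp only [mul_sub, sub_mul, mul_one, ← mul_assoc]
  rw [show P * star u * u = P * (star u * u) by rw [mul_assoc], hu, mul_one, hPP]

/-- **Lemma 3.4, (iii) ⟹ (i).** If the range of `P` is `u`-invariant (`P u = P u P`) then
`P u* (1 − P) u P = −½ u* đu`. [cite: ConnesConsani2021ScalingHamiltonian, Lemma 3.4 (iii)⟹(i) (arXiv p. 15–16)] -/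
theorem conj_compl_eq_neg_half_of_invariant {P u : H →L[ℂ] H} (hP : IsStarProjection P)
    (hu : u ∈ unitary (H →L[ℂ] H)) (hinv : P * u = P * u * P) :
    P * star u * (1 - P) * u * P = -((1 / 2 : ℂ) • (star u * quantizedDiff P u)) := by
  have hu1 : star u * u = 1 := Unitary.star_mul_self_of_mem hu
  have hPs : star P = P := hP.isSelfAdjoint.star_eq
  -- adjoint of the invariance: u* P = P u* P
  have hinv' : star u * P = P * star u * P := by
    have := congrArg star hinv
    simpa only [star_mul, hPs, mul_assoc] using this
  -- Q := u* P u satisfies Q = P Q P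
  have hQ : star u * P * u = P * (star u * P * u) * P := by
    calc star u * P * u = (star u * P) * u := by rw [mul_assoc]
      _ = P * star u * P * u := by rw [hinv']
      _ = P * star u * (P * u) := by simp only [mul_assoc]
      _ = P * star u * (P * u * P) := by rw [← hinv]
      _ = P * (star u * P * u) * P := by simp only [mul_assoc]
  rw [conj_compl_eq hu1 hP.isIdempotentElem, ← hQ, star_mul_quantizedDiff hu1, smul_smul]
  norm_num

/-- **Lemma 3.4, (i) ⟹ (ii).** The left side of (i) is a positive operator (`T* T` with `T = (1 − P) u P`),
so (i) forces `u* đu ≤ 0`. [cite: ConnesConsani2021ScalingHamiltonian, Lemma 3.4 (i)⟹(ii) (arXiv p. 15)] -/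
theorem star_mul_quantizedDiff_nonpos_of_eq {P u : H →L[ℂ] H} (hP : IsStarProjection P)
    (h : P * star u * (1 - P) * u * P = -((1 / 2 : ℂ) • (star u * quantizedDiff P u))) :
    star u * quantizedDiff P u ≤ 0 := by
  have hPs : star P = P := hP.isSelfAdjoint.star_eq
  have h1Ps : star (1 - P) = 1 - P := by rw [star_sub, star_one, hPs]
  have h1P : IsIdempotentElem (1 - P) := hP.isIdempotentElem.one_sub
  -- the left side of (i) is `T* T` with `T = (1 - P) u P`, hence nonnegative
  have hpos : 0 ≤ P * star u * (1 - P) * u * P := by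
    have hT : P * star u * (1 - P) * u * P = star ((1 - P) * u * P) * ((1 - P) * u * P) := by
      rw [star_mul, star_mul, hPs, h1Ps]
      simp only [← mul_assoc]
      rw [show P * star u * (1 - P) * (1 - P) = P * star u * ((1 - P) * (1 - P)) by
        simp only [mul_assoc], h1P.eq]
    rw [hT]
    exact star_mul_self_nonneg _
  -- `-(u* đu) = LHS + LHS ≥ 0`
  have hsum : -(star u * quantizedDiff P u) =
      P * star u * (1 - P) * u * P + P * star u * (1 - P) * u * P := by
    rw [h, ← neg_add, ← add_smul]
    norm_num
  have h0 : (0 : H →L[ℂ] H) ≤ -(star u * quantizedDiff P u) := by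
    rw [hsum]; exact add_nonneg hpos hpos
  exact neg_nonneg.mp h0

/-- **Lemma 3.4, (ii) ⟹ (iii).** If `u* đu ≤ 0` then the range of `P` is `u`-invariant: `P u = P u P`.
Proof as printed: `u* đu ≤ 0` gives `u* P u ≤ P`; testing on `x = (1 − P) y` gives `‖P u x‖² ≤ 0`.
[cite: ConnesConsani2021ScalingHamiltonian, Lemma 3.4 (ii)⟹(iii) (arXiv p. 15)] -/
theorem invariant_of_star_mul_quantizedDiff_nonpos {P u : H →L[ℂ] H} (hP : IsStarProjection P)
    (hu : u ∈ unitary (H →L[ℂ] H)) (h : star u * quantizedDiff P u ≤ 0) :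
    P * u = P * u * P := by
  have hu1 : star u * u = 1 := Unitary.star_mul_self_of_mem hu
  have hPsa : IsSelfAdjoint P := hP.isSelfAdjoint
  have hPP : ∀ z : H, P (P z) = P z := fun z ↦
    congrArg (fun T : H →L[ℂ] H ↦ T z) hP.isIdempotentElem.eq
  -- `-(u* đu) = 2 (P - u* P u)` is a positive operator
  have hpos : (-(star u * quantizedDiff P u)).IsPositive := by
    rw [← sub_zero (-(star u * quantizedDiff P u)), sub_eq_add_neg, neg_zero, add_zero, ← zero_sub]
    exact (le_def _ _).mp h
  have hD : -(star u * quantizedDiff P u) = (2 : ℂ) • (P - star u * P * u) := by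
    rw [star_mul_quantizedDiff hu1, ← smul_neg, neg_sub]
  rw [hD, two_smul] at hpos
  -- test on `x = y - P y ∈ ker P`: `re ⟪2 (P - u*Pu) x, x⟫ = -2 ‖P (u x)‖² ≥ 0`
  ext y
  set x := y - P y with hx
  have hPx : P x = 0 := by rw [hx, map_sub, hPP, sub_self]
  have hre := hpos.re_inner_nonneg_left x
  have hinner : ⟪P (u x), u x⟫_ℂ = ⟪P (u x), P (u x)⟫_ℂ := by
    rw [← hPP (u x), ← adjoint_inner_right, ← star_eq_adjoint, hPsa.star_eq, hPP]
  have h2 : (P - star u * P * u + (P - star u * P * u)) x =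
      (P x - (star u) (P (u x))) + (P x - (star u) (P (u x))) := rfl
  rw [h2, inner_add_left, map_add, inner_sub_left, hPx, inner_zero_left, zero_sub, star_eq_adjoint,
    adjoint_inner_left, hinner, inner_self_eq_norm_sq_to_K] at hre
  have hre' : (0 : ℝ) ≤ -‖P (u x)‖ ^ 2 + -‖P (u x)‖ ^ 2 := by exact_mod_cast hre
  have hn : ‖P (u x)‖ = 0 := by nlinarith [norm_nonneg (P (u x))]
  have hPux : P (u x) = 0 := norm_eq_zero.mp hn
  have h0 : P (u y) - P (u (P y)) = 0 := by
    rw [← map_sub, ← map_sub]; exact hPux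
  exact sub_eq_zero.mp h0

/-- **Connes–Consani, Lemma 3.4 (the inner-function criterion behind the semi-local cutoff), as a TFAE.**
For a unitary `u` and an orthogonal projection `P` on a complex Hilbert space, with `F = 2P − 1` and
`đu = [F, u]`: (i) `P u* (1 − P) u P = −½ u* đu` ⟺ (ii) `u* đu ≤ 0` ⟺ (iii) `P u = P u P`.
[cite: ConnesConsani2021ScalingHamiltonian, Lemma 3.4 (arXiv:1910.14368 p. 15)] -/
theorem innerCriterion_tfae {P u : H →L[ℂ] H} (hP : IsStarProjection P) (hu : u ∈ unitary (H →L[ℂ] H)) :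
    List.TFAE [P * star u * (1 - P) * u * P = -((1 / 2 : ℂ) • (star u * quantizedDiff P u)),
      star u * quantizedDiff P u ≤ 0,
      P * u = P * u * P] := by
  tfae_have 1 → 2 := star_mul_quantizedDiff_nonpos_of_eq hP
  tfae_have 2 → 3 := invariant_of_star_mul_quantizedDiff_nonpos hP hu
  tfae_have 3 → 1 := conj_compl_eq_neg_half_of_invariant hP hu
  tfae_finish

/-- **The barrier in one line**: the positive-operator identity of Li's route holds ONLY IF `range P` is
invariant under `u*` (equivalently `ker P` under `u`) — so as soon as `u*` moves one vector of `range P` out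
of `range P` (as the ratios of local factors do: «none of the functions `u_v(s)*` fulfills the requirement
of Corollary 3.5», §3 pp. 16–17) the identity fails. [cite: ConnesConsani2021ScalingHamiltonian, Lemma 3.4, Cor. 3.5 and pp. 16–17] -/
theorem positiveCutoff_identity_fails_of_not_invariant {P u : H →L[ℂ] H} (hP : IsStarProjection P)
    (hu : u ∈ unitary (H →L[ℂ] H)) {x : H} (hx : P x = x) (hout : P (star u x) ≠ star u x) :
    P * star u * (1 - P) * u * P ≠ -((1 / 2 : ℂ) • (star u * quantizedDiff P u)) := by
  intro h
  have hinv : P * u = P * u * P := ((innerCriterion_tfae hP hu).out 0 2).mp h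
  -- adjoint of the invariance: u* P = P u* P
  have hinv' : star u * P = P * star u * P := by
    have := congrArg star hinv
    simpa only [star_mul, hP.isSelfAdjoint.star_eq, mul_assoc] using this
  have key := congrArg (fun T : H →L[ℂ] H ↦ T x) hinv'
  change (star u) (P x) = P ((star u) (P x)) at key
  rw [hx] at key
  exact hout key.symm

/-- **The catalogued barrier statement** (D-0021 entry `SemilocalCutoffInnerCriterion`): on every complex Hilbert space,
for every orthogonal projection `P` and unitary `u`, the positive-operator identity of the cutoff route,
`P u* (1 − P) u P = −½ u* [2P − 1, u]`, holds iff `range P` is `u*`-invariant (`P u = P u P`), and so does the sign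
condition `u* [2P − 1, u] ≤ 0` — Connes–Consani's Lemma 3.4; by their Cor. 3.5 and pp. 16–17 the ratios of local factors
violate the invariance, which is the obstruction. Stated over `H : Type` (universe 0) to keep a closed `Prop`.
[cite: ConnesConsani2021ScalingHamiltonian, Lemma 3.4 and Cor. 3.5 (arXiv:1910.14368 p. 15), pp. 16–17] -/
def SemilocalCutoffInnerCriterion : Prop :=
  ∀ (H : Type) [NormedAddCommGroup H] [InnerProductSpace ℂ H] [CompleteSpace H] (P u : H →L[ℂ] H),
    IsStarProjection P → u ∈ unitary (H →L[ℂ] H) →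
      (P * star u * (1 - P) * u * P = -((1 / 2 : ℂ) • (star u * quantizedDiff P u)) ↔ P * u = P * u * P) ∧
      (star u * quantizedDiff P u ≤ 0 ↔ P * u = P * u * P)

/-- `SemilocalCutoffInnerCriterion` HOLDS (discharged from `innerCriterion_tfae`; zero debt).
[cite: ConnesConsani2021ScalingHamiltonian, Lemma 3.4 (arXiv:1910.14368 p. 15)] -/
theorem SemilocalCutoffInnerCriterion_holds : SemilocalCutoffInnerCriterion := by
  intro H _ _ _ P u hP hu
  have h := innerCriterion_tfae hP hu
  exact ⟨h.out 0 2, h.out 1 2⟩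

end Literature.Barriers.RiemannHypothesis
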